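import Summits.Ventures.LatticeQCDFlow.Scaling.LumpedStarPersistentLogFloor
import Summits.Ventures.LatticeQCDFlow.Scaling.HomStarFullCollectorFloor
import Summits.Ventures.LatticeQCDFlow.Scaling.HubListCurrencies

/-!
HONEST FRAMING: exact (Metropolis-corrected) sampling algorithms for lattice gauge theory; figures
of merit are autocorrelation/cost numbers at stated couplings and volumes; no continuum-physics
claim.

# HomStarPersistentLogFloor — THE LAW-FREE `½·log K` WITH PERSISTENCE AT THE SCHEME LEVEL: FOR CHAPTER U's HOMOGENEOUS REPLICA-EXCHANGE STAR (HUB LAW `μ_0`, ONE COLD LAW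
# `μ_1`, `W = μ_1/μ_0` CONSTANT OFF A DISTINGUISHED CONTENT `u`), BOTH THE POOLED LAW AND THE CONFIGURATION LAW OBEY
# **`t_mix(1/4) ≥ (K/((t+h)Λ) − 1)·(½·log K − log(72(1+c)²e^{2c}/Λ))`**, `h = (1−t)w_0`, `σ = t/(t+h)` (lean-2 GEN-46, ours)

Venture-side (OURS).  Cell `lqcd-flow` (pub-lqcd), unit `pub-lqcd-lean-2-g46`, 2026-08-31.  Chapter AF (the law-free `½·log K` with persistence), file 6 — file 5's lazy floor
carried to the venture's actual scheme `P = t·ptGraphSwap + (1−t)·prodKernel` (hub list of multiplicity `c`, exact hot redraws of weight `w_0`, idle cold levels) by chapter AD's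
lumping: every lumped state is a `Λ`-image (its `π_S`-mass is a positive fibre sum, AD15: `π_S = Λ_*(μ_0⊗μ_1⊗⋯⊗μ_1)`), `δ_{Λy}S_lⁿ = Λ_*(δ_yPⁿ)` (AD9) and a lumping never increases total
variation (AE15), so `d_{S_l}(n) ≤ d_P(n)` for every `n` and `t_mix^{S_l}(ε) ≤ t_mix^{P}(ε)`; file 5's floor for `S_l = tA + hB + (1−t−h)I` is therefore a floor for the scheme.
Persistence pattern: `acc(u,v) = α`, `acc(v,u) = β` off `u` with `acc(h,v) = min{1, W_h/W_v}`, i.e. `W = μ_1/μ_0` constant off `u` (two contents; one persistent ∕ volatile content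
type among equals).  Hypothesis-equations only, no definitions.

* **`homStar_pooled_worstTvDist_le_config`** (`d_{S_l}(n) ≤ d_P(n)`, general laws), **`homStar_pooled_mixingTime_le_config`** (`t_mix^{S_l}(ε) ≤ t_mix^P(ε)` when `P` is `ε`-close at some
  time), **`homStar_exists_worstTvDist_le`** (the homogeneous scheme is row-stochastic, reversible for `⊗μ`, irreducible — chapter K file 6 — and aperiodic, hence `ε`-close at some time
  for every `ε > 0`: LPW 4.9), **`homStar_persistent_mixingTime_ge`** (the floor, as displayed, for the configuration law against `μ_0⊗μ_1⊗⋯⊗μ_1`, UNCONDITIONALLY in the chain).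

Reading (no numerics implied): against AD12's ceiling `(96(c+2K+2)(t+h)/(t·h·p̄))·log(…/ε)` for the pooled law, and at constant persistence AE18 ∕ AE20's two-sided
`Θ((K(t+h)/(th))·log K)`: with persistence on this pattern the venture's homogeneous replica-exchange star keeps the logarithm on the floor side for EVERY hub law, in the unit
`K/((t+h)Λ) = (K(t+h)/(th))·((1−σ)c̄ + σαβ)/c̄²`.  Literature grade (cell rule): OWN assembly on files 1–5 and chapter AD ∕ AE lumping; nothing new cited; no new bib keys.
-/

noncomputable section

open Finset Function
open Literature.Probability.MarkovChains

namespace Summit.Ventures.LatticeQCDFlow.Scaling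

section SchemePersistent
variable {S : Type*} [Fintype S] [DecidableEq S] {K m : ℕ} (κ : Fin m → Fin K) {μ : Fin (K + 1) → S → ℝ} {M : Fin (K + 1) → S → S → ℝ} {w : Fin (K + 1) → ℝ} {t : ℝ} {c : ℕ}
variable {X : Type*} [Fintype X] [DecidableEq X] {hub : X → S} {comp : X → S → ℕ} {W : S → ℝ} {acc : S → S → ℝ} {Kh : (S → ℕ) → S → S → ℝ}
variable {Ast Bst Sl : X → X → ℝ} {g : (S → ℕ) → ℝ} {πS : X → ℝ} {Z : ℝ}
variable {Λ : (Fin (K + 1) → S) → X}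

/-- **THE POOLED DISTANCE NEVER EXCEEDS THE CONFIGURATION DISTANCE:** under X5's closed form for `π_S` (`= Λ_*⊗μ`, AD15), for every `n`, **`d_{S_l}(n) ≤ d_P(n)`** against
`μ_0⊗μ_1⊗⋯⊗μ_1` (every lumped state is a `Λ`-image; AD9; AE15). [ours] -/
theorem homStar_pooled_worstTvDist_le_config [Nonempty X] (hm : 1 ≤ m) (hμ : ∀ k x, 0 < μ k x) (hμsum : ∀ k, ∑ u, μ k u = 1)
    (hhom : ∀ i : Fin K, μ i.succ = μ 1) (hw0 : ∀ k, 0 ≤ w k) (hw00 : 0 < w 0) (hw1 : ∑ k, w k = 1) (ht0 : 0 < t) (ht1 : t < 1)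
    (hM0 : ∀ u v, M 0 u v = μ 0 v) (hidle : ∀ i : Fin K, ∀ u v, M i.succ u v = if v = u then 1 else 0)
    (hunif : ∀ i : Fin K, (univ.filter fun r : Fin m => κ r = i).card = c)
    (hWdef : ∀ v, W v = μ 1 v / μ 0 v) (hinj : ∀ x x', hub x = hub x' → comp x = comp x' → x = x') (hsum : ∀ x, ∑ v, comp x v = K + 1)
    (hsurj : ∀ (z : S) (N : S → ℕ), ∑ v, N v = K + 1 → N z ≠ 0 → ∃ x, hub x = z ∧ comp x = N) (hhub : ∀ x, comp x (hub x) ≠ 0) (hK : 1 ≤ K)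
    (hacc : ∀ h v, acc h v = min 1 (W h / W v))
    (hKoff : ∀ N h v, h ≠ v → Kh N h v = if N h = 0 then 0 else (N v : ℝ) / K * acc h v) (hKdiag : ∀ N h, Kh N h h = 1 - ∑ v ∈ univ.erase h, Kh N h v)
    (hA : ∀ x x', Ast x x' = if comp x' = comp x then Kh (comp x) (hub x) (hub x') else 0)
    (hB : ∀ x x', Bst x x' = μ 0 (hub x') * (if comp x' + Pi.single (hub x) 1 = comp x + Pi.single (hub x') 1 then 1 else 0))
    (hSl : ∀ x x', Sl x x' = t * Ast x x' + (1 - t) * (w 0 * Bst x x' + (1 - w 0) * (if x = x' then 1 else 0)))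
    (hg : ∀ N, g N = ∏ v, (μ 0 v * W v) ^ (N v) / ((N v).factorial : ℝ))
    (hZ : Z = ∑ x, g (comp x) * ((comp x (hub x) : ℝ) / W (hub x))) (hπS : ∀ x, πS x = g (comp x) * ((comp x (hub x) : ℝ) / W (hub x)) / Z)
    (hΛh : ∀ y, hub (Λ y) = y 0) (hΛc : ∀ y v, comp (Λ y) v = (univ.filter fun k : Fin (K + 1) => y k = v).card) (n : ℕ) :
    worstTvDist Sl πS n ≤ worstTvDist (fun y z : Fin (K + 1) → S => t * ptGraphSwap μ
          (fun r : Fin m => (((0 : Fin (K + 1)), (κ r).succ) : Fin (K + 1) × Fin (K + 1))) (fun _ => Equiv.refl S) y z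
          + (1 - t) * prodKernel w M y z) (tensorFun μ) n := by
  classical
  have hW : ∀ v, 0 < W v := fun v => by rw [hWdef]; exact div_pos (hμ 1 v) (hμ 0 v)
  have hπ : ∀ x, πS x = ∑ y ∈ univ.filter (fun y => Λ y = x), tensorFun μ y := fun x =>
    homStar_piS_eq_pushforward κ hm hμ hμsum hhom hw0 hw00 hw1 ht0 ht1 hM0 hidle hunif hWdef hinj hsum hsurj hhub hK hacc hKoff hKdiag hA hB hSl hg hZ hπS hΛh hΛc x
  have hπfun : πS = fun x => ∑ y ∈ univ.filter (fun y => Λ y = x), tensorFun μ y := funext hπ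
  have hπpos := lumpedStar_piS_pos hhub hW (hμ 0) hg hZ hπS
  -- every state is a `Λ`-image
  have hsurjΛ : ∀ x, ∃ y, Λ y = x := by
    intro x
    by_contra hx
    push Not at hx
    have h0 : πS x = 0 := by
      rw [hπ x]; exact Finset.sum_eq_zero fun y hy => (hx y (mem_filter.mp hy).2).elim
    exact (lt_irrefl (0 : ℝ)) (h0 ▸ hπpos x)
  -- the `W`-free acceptance of AD9
  have hacc' : ∀ a b, acc a b = min 1 (μ 0 b * μ 1 a / (μ 0 a * μ 1 b)) := by
    intro a b
    rw [hacc, hWdef, hWdef]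
    congr 1
    field_simp [(hμ 0 a).ne', (hμ 0 b).ne', (hμ 1 a).ne', (hμ 1 b).ne']
  refine Real.iSup_le (fun x => ?_) (worstTvDist_nonneg _ _ n)
  obtain ⟨y, hy⟩ := hsurjΛ x
  have hpush := homStar_pushforward_lawAt κ hm hμ hhom hw1 hM0 hidle hunif hacc' hKoff hKdiag hA hB hSl hΛh hΛc hinj (Pi.single y 1) n
  have hδ : (fun x' => ∑ y' ∈ univ.filter (fun y' => Λ y' = x'), (Pi.single y (1 : ℝ) : (Fin (K + 1) → S) → ℝ) y') = Pi.single x 1 := by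
    rw [← hy]; exact funext fun x' => lumping_pushforward_single y x'
  rw [hδ] at hpush
  rw [← hpush, hπfun]
  exact (tvDist_pushforward_le Λ _ _).trans (tvDist_single_le_worstTvDist _ _ n y)

/-- **HENCE `t_mix^{S_l}(ε) ≤ t_mix^{P}(ε)`** whenever the scheme is `ε`-close to `μ_0⊗μ_1⊗⋯⊗μ_1` at some time. [ours] -/
theorem homStar_pooled_mixingTime_le_config [Nonempty X] (hm : 1 ≤ m) (hμ : ∀ k x, 0 < μ k x) (hμsum : ∀ k, ∑ u, μ k u = 1)
    (hhom : ∀ i : Fin K, μ i.succ = μ 1) (hw0 : ∀ k, 0 ≤ w k) (hw00 : 0 < w 0) (hw1 : ∑ k, w k = 1) (ht0 : 0 < t) (ht1 : t < 1)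
    (hM0 : ∀ u v, M 0 u v = μ 0 v) (hidle : ∀ i : Fin K, ∀ u v, M i.succ u v = if v = u then 1 else 0)
    (hunif : ∀ i : Fin K, (univ.filter fun r : Fin m => κ r = i).card = c)
    (hWdef : ∀ v, W v = μ 1 v / μ 0 v) (hinj : ∀ x x', hub x = hub x' → comp x = comp x' → x = x') (hsum : ∀ x, ∑ v, comp x v = K + 1)
    (hsurj : ∀ (z : S) (N : S → ℕ), ∑ v, N v = K + 1 → N z ≠ 0 → ∃ x, hub x = z ∧ comp x = N) (hhub : ∀ x, comp x (hub x) ≠ 0) (hK : 1 ≤ K)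
    (hacc : ∀ h v, acc h v = min 1 (W h / W v))
    (hKoff : ∀ N h v, h ≠ v → Kh N h v = if N h = 0 then 0 else (N v : ℝ) / K * acc h v) (hKdiag : ∀ N h, Kh N h h = 1 - ∑ v ∈ univ.erase h, Kh N h v)
    (hA : ∀ x x', Ast x x' = if comp x' = comp x then Kh (comp x) (hub x) (hub x') else 0)
    (hB : ∀ x x', Bst x x' = μ 0 (hub x') * (if comp x' + Pi.single (hub x) 1 = comp x + Pi.single (hub x') 1 then 1 else 0))
    (hSl : ∀ x x', Sl x x' = t * Ast x x' + (1 - t) * (w 0 * Bst x x' + (1 - w 0) * (if x = x' then 1 else 0)))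
    (hg : ∀ N, g N = ∏ v, (μ 0 v * W v) ^ (N v) / ((N v).factorial : ℝ))
    (hZ : Z = ∑ x, g (comp x) * ((comp x (hub x) : ℝ) / W (hub x))) (hπS : ∀ x, πS x = g (comp x) * ((comp x (hub x) : ℝ) / W (hub x)) / Z)
    (hΛh : ∀ y, hub (Λ y) = y 0) (hΛc : ∀ y v, comp (Λ y) v = (univ.filter fun k : Fin (K + 1) => y k = v).card) {ε : ℝ}
    (hmix : ∃ t₀, worstTvDist (fun y z : Fin (K + 1) → S => t * ptGraphSwap μ
          (fun r : Fin m => (((0 : Fin (K + 1)), (κ r).succ) : Fin (K + 1) × Fin (K + 1))) (fun _ => Equiv.refl S) y z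
          + (1 - t) * prodKernel w M y z) (tensorFun μ) t₀ ≤ ε) :
    mixingTime Sl πS ε ≤ mixingTime (fun y z : Fin (K + 1) → S => t * ptGraphSwap μ
          (fun r : Fin m => (((0 : Fin (K + 1)), (κ r).succ) : Fin (K + 1) × Fin (K + 1))) (fun _ => Equiv.refl S) y z
          + (1 - t) * prodKernel w M y z) (tensorFun μ) ε := by
  obtain ⟨t₀, ht₀⟩ := hmix
  have hd := worstTvDist_mixingTime_le _ _ ht₀
  have hle := homStar_pooled_worstTvDist_le_config κ hm hμ hμsum hhom hw0 hw00 hw1 ht0 ht1 hM0 hidle hunif hWdef hinj hsum hsurj hhub hK hacc hKoff hKdiag hA hB hSl hg hZ hπS hΛh hΛc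
    (mixingTime (fun y z : Fin (K + 1) → S => t * ptGraphSwap μ
          (fun r : Fin m => (((0 : Fin (K + 1)), (κ r).succ) : Fin (K + 1) × Fin (K + 1))) (fun _ => Equiv.refl S) y z
          + (1 - t) * prodKernel w M y z) (tensorFun μ) ε)
  exact mixingTime_le _ _ (hle.trans hd)

/-- **THE HOMOGENEOUS SCHEME CONVERGES:** with exact hot redraws (`M_0(u,·) = μ_0 > 0`), idle cold levels, hot weight `w_0 > 0`, `0 < t < 1` and a hub list reaching every
cold level, `P = t·ptGraphSwap + (1−t)·prodKernel` is row-stochastic, irreducible (chapter K file 6: from the hot update), aperiodic (the hot redraw holds with probability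
`(1−t)w_0μ_0(x_0) > 0`) and reversible for `μ_0⊗μ_1⊗⋯⊗μ_K`, so for every `ε > 0` it is `ε`-close at some time (LPW Thm 4.9). [ours] -/
theorem homStar_exists_worstTvDist_le (hm : 1 ≤ m) (hμ : ∀ k x, 0 < μ k x) (hμsum : ∀ k, ∑ u, μ k u = 1)
    (hw0 : ∀ k, 0 ≤ w k) (hw00 : 0 < w 0) (hw1 : ∑ k, w k = 1) (ht0 : 0 < t) (ht1 : t < 1)
    (hM0 : ∀ u v, M 0 u v = μ 0 v) (hidle : ∀ i : Fin K, ∀ u v, M i.succ u v = if v = u then 1 else 0)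
    (hunif : ∀ i : Fin K, (univ.filter fun r : Fin m => κ r = i).card = c) {ε : ℝ} (hε : 0 < ε) :
    IsRowStochastic (fun y z : Fin (K + 1) → S => t * ptGraphSwap μ
          (fun r : Fin m => (((0 : Fin (K + 1)), (κ r).succ) : Fin (K + 1) × Fin (K + 1))) (fun _ => Equiv.refl S) y z
          + (1 - t) * prodKernel w M y z) ∧
    IsStationary (tensorFun μ) (fun y z : Fin (K + 1) → S => t * ptGraphSwap μ
          (fun r : Fin m => (((0 : Fin (K + 1)), (κ r).succ) : Fin (K + 1) × Fin (K + 1))) (fun _ => Equiv.refl S) y z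
          + (1 - t) * prodKernel w M y z) ∧
    ∃ t₀, worstTvDist (fun y z : Fin (K + 1) → S => t * ptGraphSwap μ
          (fun r : Fin m => (((0 : Fin (K + 1)), (κ r).succ) : Fin (K + 1) × Fin (K + 1))) (fun _ => Equiv.refl S) y z
          + (1 - t) * prodKernel w M y z) (tensorFun μ) t₀ ≤ ε := by
  classical
  -- the replica kernels are transition matrices, reversible for `μ_k`
  have hM : ∀ k, IsRowStochastic (M k) := by
    intro k
    refine Fin.cases ?_ (fun i => ?_) k
    · exact ⟨fun u v => by rw [hM0]; exact (hμ 0 v).le, fun u => by simp_rw [hM0]; exact hμsum 0⟩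
    · refine ⟨fun u v => by rw [hidle]; split_ifs <;> norm_num, fun u => ?_⟩
      simp_rw [hidle i]
      rw [Finset.sum_ite_eq' univ u]; simp
  have hMrev : ∀ k, DetailedBalance (μ k) (M k) := by
    intro k
    refine Fin.cases ?_ (fun i => ?_) k
    · intro u v; rw [hM0, hM0]; ring
    · intro u v
      rw [hidle, hidle]
      by_cases huv : u = v
      · subst huv; rfl
      · rw [if_neg (fun h => huv h.symm), if_neg huv, mul_zero, mul_zero]
  have hQ := ptGraphSwap_isRowStochastic (e := fun r : Fin m => (((0 : Fin (K + 1)), (κ r).succ) : Fin (K + 1) × Fin (K + 1))) (φ := fun _ : Fin m => Equiv.refl S) hμ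
  have hP : IsRowStochastic (fun y z : Fin (K + 1) → S => t * ptGraphSwap μ
          (fun r : Fin m => (((0 : Fin (K + 1)), (κ r).succ) : Fin (K + 1) × Fin (K + 1))) (fun _ => Equiv.refl S) y z
          + (1 - t) * prodKernel w M y z) := weightedScheme_isRowStochastic hQ hM hw0 hw1 ht0.le ht1.le
  -- stationarity by detailed balance
  have hDB := weightedScheme_detailedBalance (w := w) (ptGraphSwap_detailedBalance
    (e := fun r : Fin m => (((0 : Fin (K + 1)), (κ r).succ) : Fin (K + 1) × Fin (K + 1))) (φ := fun _ : Fin m => Equiv.refl S) hμ) hMrev t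
  have hst := hDB.isStationary hP.2
  -- irreducible from the hot update (chapter K file 6)
  have hc1 : 1 ≤ c := by
    have h := hunif (κ ⟨0, by omega⟩)
    have hmem : (⟨0, by omega⟩ : Fin m) ∈ univ.filter (fun r : Fin m => κ r = κ ⟨0, by omega⟩) := mem_filter.mpr ⟨mem_univ _, rfl⟩
    have := Finset.card_pos.mpr ⟨_, hmem⟩
    omega
  have hhub' : ∀ k : Fin K, ∃ j : Fin m, (fun r : Fin m => (((0 : Fin (K + 1)), (κ r).succ) : Fin (K + 1) × Fin (K + 1))) j = ((0 : Fin (K + 1)), k.succ) := by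
    intro k
    have hne : (univ.filter fun r : Fin m => κ r = k).Nonempty := by
      rw [← Finset.card_pos, hunif k]; omega
    obtain ⟨j, hj⟩ := hne
    exact ⟨j, by simp only [(mem_filter.mp hj).2]⟩
  have hM0irr : IsIrreducible (M 0) := fun u v => ⟨1, by rw [pow_one, hM0]; exact hμ 0 v⟩
  have hirr := hubGraph_isIrreducible_of_hot (e := fun r : Fin m => (((0 : Fin (K + 1)), (κ r).succ) : Fin (K + 1) × Fin (K + 1))) (w := w)
    (fun r => (Fin.succ_ne_zero (κ r)).symm) hhub' hμ hM hM0irr hw0 hw1 hw00 ht0 ht1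
  -- aperiodic: the hot redraw holds
  have hap : IsAperiodic (fun y z : Fin (K + 1) → S => t * ptGraphSwap μ
          (fun r : Fin m => (((0 : Fin (K + 1)), (κ r).succ) : Fin (K + 1) × Fin (K + 1))) (fun _ => Equiv.refl S) y z
          + (1 - t) * prodKernel w M y z) := by
    refine isAperiodic_of_diag_pos fun x => ?_
    have h1 : 0 ≤ t * ptGraphSwap μ (fun r : Fin m => (((0 : Fin (K + 1)), (κ r).succ) : Fin (K + 1) × Fin (K + 1))) (fun _ => Equiv.refl S) x x :=
      mul_nonneg ht0.le (hQ.1 x x)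
    have h2 : w 0 * M 0 (x 0) (x 0) ≤ prodKernel w M x x := by
      rw [prodKernel_self]
      exact Finset.single_le_sum (f := fun k => w k * M k (x k) (x k)) (fun k _ => mul_nonneg (hw0 k) ((hM k).1 _ _)) (mem_univ 0)
    have h3 : 0 < w 0 * M 0 (x 0) (x 0) := by rw [hM0]; exact mul_pos hw00 (hμ 0 _)
    have h4 : 0 < (1 - t) * prodKernel w M x x := mul_pos (by linarith) (lt_of_lt_of_le h3 h2)
    show 0 < t * _ + (1 - t) * prodKernel w M x x
    linarith
  have hπ0 : ∀ y, 0 ≤ tensorFun μ y := fun y => (tensorFun_pos hμ y).le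
  have hπ1 : ∑ y, tensorFun μ y = 1 := by rw [sum_tensorFun]; exact Finset.prod_eq_one fun j _ => hμsum j
  exact ⟨hP, hst, exists_worstTvDist_le hP hirr hap hst hπ0 hπ1 hε⟩

/-- **THE LAW-FREE `½·log K` WITH PERSISTENCE FOR THE VENTURE's HOMOGENEOUS SCHEME.**  Chapter U's homogeneous replica-exchange star (`K ≥ 2`, hub list with every cold level
listed `c` times, swap probability `0 < t < 1`, update weights `w ≥ 0` of unit mass with hot weight `w_0 > 0`, exact hot redraws, idle cold levels, positive laws `μ_0` and `μ_1 = μ_2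
= ⋯`), persistence `W = μ_1/μ_0` with the pattern `acc(u,v) = α`, `acc(v,u) = β` for `v ≠ u` (`α, β ∈ (0,1]`), another content `w' ≠ u`, `h = (1−t)w_0`, `σ = t/(t+h)` with
`σ ≤ (1−σ)K`, and the constants of file 3a at `p = μ_0(u)`:
**`t_mix(1/4) ≥ (K/((t+h)Λ) − 1)·(½·log K − log(72(1+c)²e^{2c}/Λ))`** for the configuration law (and, by file 5, for the pooled law) — UNCONDITIONALLY IN THE CHAIN
(convergence discharged by `homStar_exists_worstTvDist_le`). [ours] -/
theorem homStar_persistent_mixingTime_ge [Nonempty X] (hm : 1 ≤ m) (hμ : ∀ k x, 0 < μ k x) (hμsum : ∀ k, ∑ u, μ k u = 1)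
    (hhom : ∀ i : Fin K, μ i.succ = μ 1) (hw0 : ∀ k, 0 ≤ w k) (hw00 : 0 < w 0) (hw1 : ∑ k, w k = 1) (ht0 : 0 < t) (ht1 : t < 1)
    (hM0 : ∀ u v, M 0 u v = μ 0 v) (hidle : ∀ i : Fin K, ∀ u v, M i.succ u v = if v = u then 1 else 0)
    (hunif : ∀ i : Fin K, (univ.filter fun r : Fin m => κ r = i).card = c)
    (hWdef : ∀ v, W v = μ 1 v / μ 0 v) (hinj : ∀ x x', hub x = hub x' → comp x = comp x' → x = x') (hsum : ∀ x, ∑ v, comp x v = K + 1)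
    (hsurj : ∀ (z : S) (N : S → ℕ), ∑ v, N v = K + 1 → N z ≠ 0 → ∃ x, hub x = z ∧ comp x = N) (hhub : ∀ x, comp x (hub x) ≠ 0) (hK : 2 ≤ K)
    (hacc : ∀ h v, acc h v = min 1 (W h / W v))
    (hKoff : ∀ N h v, h ≠ v → Kh N h v = if N h = 0 then 0 else (N v : ℝ) / K * acc h v) (hKdiag : ∀ N h, Kh N h h = 1 - ∑ v ∈ univ.erase h, Kh N h v)
    (hA : ∀ x x', Ast x x' = if comp x' = comp x then Kh (comp x) (hub x) (hub x') else 0)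
    (hB : ∀ x x', Bst x x' = μ 0 (hub x') * (if comp x' + Pi.single (hub x) 1 = comp x + Pi.single (hub x') 1 then 1 else 0))
    (hSl : ∀ x x', Sl x x' = t * Ast x x' + (1 - t) * (w 0 * Bst x x' + (1 - w 0) * (if x = x' then 1 else 0)))
    (hg : ∀ N, g N = ∏ v, (μ 0 v * W v) ^ (N v) / ((N v).factorial : ℝ))
    (hZ : Z = ∑ x, g (comp x) * ((comp x (hub x) : ℝ) / W (hub x))) (hπS : ∀ x, πS x = g (comp x) * ((comp x (hub x) : ℝ) / W (hub x)) / Z)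
    (hΛh : ∀ y, hub (Λ y) = y 0) (hΛc : ∀ y v, comp (Λ y) v = (univ.filter fun k : Fin (K + 1) => y k = v).card)
    (u w' : S) (hw' : w' ≠ u) {α β σ : ℝ} (hα0 : 0 < α) (hα1 : α ≤ 1) (hβ0 : 0 < β) (hβ1 : β ≤ 1)
    (hαu : ∀ v, v ≠ u → acc u v = α) (hβu : ∀ v, v ≠ u → acc v u = β) (hσ : σ = t / (t + (1 - t) * w 0)) (hKσ : σ ≤ (1 - σ) * K)
    {cbar gs D0 Λr γ cc : ℝ} (hcbar : cbar = μ 0 u * α + (1 - μ 0 u) * β) (hgs : gs = μ 0 u * α / cbar) (hD0 : D0 = (1 - σ) + σ * α * β / cbar)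
    (hΛ : Λr = σ * (1 - σ) * cbar / D0) (hγ : γ = σ * (β - α) / D0) (hc : cc = σ / D0) :
    ((K : ℝ) / ((t + (1 - t) * w 0) * Λr) - 1) * (Real.log K / 2 - Real.log (72 * (1 + cc) ^ 2 * Real.exp (2 * cc) / Λr))
      ≤ (mixingTime (fun y z : Fin (K + 1) → S => t * ptGraphSwap μ
          (fun r : Fin m => (((0 : Fin (K + 1)), (κ r).succ) : Fin (K + 1) × Fin (K + 1))) (fun _ => Equiv.refl S) y z
          + (1 - t) * prodKernel w M y z) (tensorFun μ) (1 / 4) : ℝ) := by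
  have hK1 : 1 ≤ K := by omega
  obtain ⟨-, -, hmix⟩ := homStar_exists_worstTvDist_le κ hm hμ hμsum hw0 hw00 hw1 ht0 ht1 hM0 hidle hunif (by norm_num : (0 : ℝ) < 1 / 4)
  have hW : ∀ v, 0 < W v := fun v => by rw [hWdef]; exact div_pos (hμ 1 v) (hμ 0 v)
  have hw0le : w 0 ≤ 1 := by
    have := Finset.single_le_sum (fun k _ => hw0 k) (mem_univ (0 : Fin (K + 1))); rw [hw1] at this; exact this
  have h1t : 0 < 1 - t := by linarith
  have hh0 : 0 < (1 - t) * w 0 := mul_pos h1t hw00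
  have hth : t + (1 - t) * w 0 ≤ 1 := by nlinarith
  -- `S_l` in file 5's form
  have hSl' : ∀ x x', Sl x x' = t * Ast x x' + ((1 - t) * w 0) * Bst x x' + (1 - t - (1 - t) * w 0) * (if x = x' then 1 else 0) :=
    fun x x' => by rw [hSl]; ring
  have hfloor := lumpedStar_lazy_mixingTime_ge_persistent hinj hsurj hhub hsum hK hW hacc (hμsum 0) (hμ 0) ht0 hh0 hth hσ hKσ hKoff hKdiag hA hB hSl' hg hZ hπS
    u w' hw' hα0 hα1 hβ0 hβ1 hαu hβu hcbar hgs hD0 hΛ hγ hc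
  have hle := homStar_pooled_mixingTime_le_config κ hm hμ hμsum hhom hw0 hw00 hw1 ht0 ht1 hM0 hidle hunif hWdef hinj hsum hsurj hhub hK1 hacc hKoff hKdiag hA hB hSl hg hZ hπS
    hΛh hΛc hmix
  have hcast : (mixingTime Sl πS (1 / 4) : ℝ) ≤ (mixingTime (fun y z : Fin (K + 1) → S => t * ptGraphSwap μ
          (fun r : Fin m => (((0 : Fin (K + 1)), (κ r).succ) : Fin (K + 1) × Fin (K + 1))) (fun _ => Equiv.refl S) y z
          + (1 - t) * prodKernel w M y z) (tensorFun μ) (1 / 4) : ℝ) := by exact_mod_cast hle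
  exact hfloor.trans hcast

end SchemePersistent

end Summit.Ventures.LatticeQCDFlow.Scaling

end
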